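import Literature.Algebra.Homology.ExtDualityPairing
import Mathlib.CategoryTheory.Preadditive.Biproducts
import HarnessLib

/-!
# The duality maps `α^r` on a binary direct sum: `α^r(X ⊞ Y)` is injective / surjective iff
# `α^r(X)` and `α^r(Y)` are (Milne ADT I 1.8 / Harari 16.21, additivity step)

Topic `Algebra/Homology`; namespace `Literature.Algebra.Homology.ExtDuality`.  Theorems only, for
Mathlib's `Abelian.Ext` in any abelian category with `HasExt`; no definition, no named fact, no
instance, no `sorry`.  Sequel of `ExtDualityPairing` (`⟨x, y⟩ = inv (y ∘ x)`, `adjointMap = α^r`,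
`pairing_mk₀_comp`).

In the proof of Tate's duality theorem (Milne ADT I Thm. 1.8, Harari Thm. 16.21) the maps
`α^r(G, M)` for a module with TRIVIAL action are reduced to the cases `M = ℤ`, `M = ℤ/m` ("(1.7) shows
that they are true … whenever the action of `G` on `M` is trivial"): this uses the additivity of
`α^r` in `M`.  Here, for a binary biproduct `X ⊞ Y` and the duality maps
`α_M = adjointMap inv M h : Extʳ(M, C) →+ Hom(Extˢ(P, M), Q)` (`s + r = 2`):

* `adjointMap_biprod_eq_zero_iff`-type bookkeeping: `x ∈ Extʳ(X ⊞ Y, C)` is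
  `fst^* (inl^* x) + snd^* (inr^* x)`; `⟨fst^* x', y⟩ = ⟨x', fst_* y⟩` etc. (`pairing_mk₀_comp`);
* **`adjointInjective_biprod_iff`**: `α(X ⊞ Y)` injective `↔` `α(X)` and `α(Y)` injective;
* **`adjointSurjective_biprod_iff`**: `α(X ⊞ Y)` surjective `↔` `α(X)` and `α(Y)` surjective;
* `adjointBijective_biprod_iff`.

Written for Route A of the Poitou–Tate programme of crux `stmt-BirchSwinnertonDyer-19295` (cell
`bsd-schneider-ideate`, seat door-c4 gen 15).  HONEST FRAMING: homological algebra only.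

## References
* J. S. Milne, *Arithmetic Duality Theorems* (2nd ed. 2006), I §1, proof of Theorem 1.8 (reduction to
  `ℤ` and `ℤ/m` for trivial action, p. 22). [MilneADT2006]
* D. Harari, *Galois Cohomology and Class Field Theory*, Universitext (2020), §16.3, Lemma 16.19 –
  Theorem 16.21. [Harari2020]
-/

noncomputable section

universe w' w v u

namespace Literature.Algebra.Homology

namespace ExtDuality

open CategoryTheory CategoryTheory.Limits CategoryTheory.Abelian

variable {𝒞 : Type u} [Category.{v} 𝒞] [Abelian 𝒞] [HasExt.{w} 𝒞]
  {P C : 𝒞} {Q : Type w'} [AddCommGroup Q] (inv : Ext P C 2 →+ Q) (X Y : 𝒞)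

/-! ## §1 Decomposition of classes on `X ⊞ Y` -/

omit [HasExt.{w} 𝒞] in
/-- `𝟙_{X ⊞ Y} = fst ≫ inl + snd ≫ inr`. [cite: MilneADT2006, I Theorem 1.8 (proof)] -/
theorem biprod_id_eq : (𝟙 (X ⊞ Y) : X ⊞ Y ⟶ X ⊞ Y) = biprod.fst ≫ biprod.inl + biprod.snd ≫ biprod.inr :=
  (biprod.total).symm

/-- **First variable**: `x = fst^* (inl^* x) + snd^* (inr^* x)` for `x ∈ Extʳ(X ⊞ Y, C)`.
[cite: MilneADT2006, I Theorem 1.8 (proof)] -/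
theorem ext_biprod_fst_eq {r : ℕ} (x : Ext (X ⊞ Y) C r) :
    x = (Ext.mk₀ (biprod.fst : X ⊞ Y ⟶ X)).comp ((Ext.mk₀ (biprod.inl : X ⟶ X ⊞ Y)).comp x (zero_add r))
        (zero_add r) +
      (Ext.mk₀ (biprod.snd : X ⊞ Y ⟶ Y)).comp ((Ext.mk₀ (biprod.inr : Y ⟶ X ⊞ Y)).comp x (zero_add r))
        (zero_add r) := by
  rw [Ext.mk₀_comp_mk₀_assoc, Ext.mk₀_comp_mk₀_assoc, ← Ext.add_comp, ← Ext.mk₀_add, ← biprod_id_eq,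
    Ext.mk₀_id_comp]

/-- **Second variable**: `y = inl_* (fst_* y) + inr_* (snd_* y)` for `y ∈ Extˢ(P, X ⊞ Y)`.
[cite: MilneADT2006, I Theorem 1.8 (proof)] -/
theorem ext_biprod_snd_eq {s : ℕ} (y : Ext P (X ⊞ Y) s) :
    y = (y.comp (Ext.mk₀ (biprod.fst : X ⊞ Y ⟶ X)) (add_zero s)).comp (Ext.mk₀ (biprod.inl : X ⟶ X ⊞ Y))
        (add_zero s) +
      (y.comp (Ext.mk₀ (biprod.snd : X ⊞ Y ⟶ Y)) (add_zero s)).comp (Ext.mk₀ (biprod.inr : Y ⟶ X ⊞ Y))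
        (add_zero s) := by
  rw [Ext.comp_assoc_of_third_deg_zero, Ext.comp_assoc_of_third_deg_zero, Ext.mk₀_comp_mk₀,
    Ext.mk₀_comp_mk₀, ← Ext.comp_add, ← Ext.mk₀_add, ← biprod_id_eq, Ext.comp_mk₀_id]

/-! ## §2 Injectivity -/

/-- **`α(X ⊞ Y)` injective ⟹ `α(X)` injective.** [cite: MilneADT2006, I Theorem 1.8 (proof)][cite: Harari2020, §16.3 Theorem 16.21] -/
theorem adjointInjective_of_biprod_left {r s : ℕ} (h : s + r = 2)
    (hXY : AdjointInjective inv (X ⊞ Y) h) : AdjointInjective inv X h := by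
  intro x x' hxx'
  have key : (Ext.mk₀ (biprod.fst : X ⊞ Y ⟶ X)).comp x (zero_add r) =
      (Ext.mk₀ (biprod.fst : X ⊞ Y ⟶ X)).comp x' (zero_add r) := by
    apply hXY
    rw [adjointMap_mk₀_comp, adjointMap_mk₀_comp, hxx']
  have := congrArg (fun z => (Ext.mk₀ (biprod.inl : X ⟶ X ⊞ Y)).comp z (zero_add r)) key
  simpa only [Ext.mk₀_comp_mk₀_assoc, biprod.inl_fst, Ext.mk₀_id_comp] using this

/-- **`α(X ⊞ Y)` injective ⟹ `α(Y)` injective.** [cite: MilneADT2006, I Theorem 1.8 (proof)][cite: Harari2020, §16.3 Theorem 16.21] -/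
theorem adjointInjective_of_biprod_right {r s : ℕ} (h : s + r = 2)
    (hXY : AdjointInjective inv (X ⊞ Y) h) : AdjointInjective inv Y h := by
  intro x x' hxx'
  have key : (Ext.mk₀ (biprod.snd : X ⊞ Y ⟶ Y)).comp x (zero_add r) =
      (Ext.mk₀ (biprod.snd : X ⊞ Y ⟶ Y)).comp x' (zero_add r) := by
    apply hXY
    rw [adjointMap_mk₀_comp, adjointMap_mk₀_comp, hxx']
  have := congrArg (fun z => (Ext.mk₀ (biprod.inr : Y ⟶ X ⊞ Y)).comp z (zero_add r)) key
  simpa only [Ext.mk₀_comp_mk₀_assoc, biprod.inr_snd, Ext.mk₀_id_comp] using this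

/-- **`α(X)`, `α(Y)` injective ⟹ `α(X ⊞ Y)` injective.** [cite: MilneADT2006, I Theorem 1.8 (proof)][cite: Harari2020, §16.3 Theorem 16.21] -/
theorem adjointInjective_biprod {r s : ℕ} (h : s + r = 2) (hX : AdjointInjective inv X h)
    (hY : AdjointInjective inv Y h) : AdjointInjective inv (X ⊞ Y) h := by
  rw [AdjointInjective, injective_iff_map_eq_zero]
  intro x hx
  have hX' : (Ext.mk₀ (biprod.inl : X ⟶ X ⊞ Y)).comp x (zero_add r) = 0 := by
    rw [← map_eq_zero_iff _ hX, adjointMap_mk₀_comp, hx, AddMonoidHom.zero_comp]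
  have hY' : (Ext.mk₀ (biprod.inr : Y ⟶ X ⊞ Y)).comp x (zero_add r) = 0 := by
    rw [← map_eq_zero_iff _ hY, adjointMap_mk₀_comp, hx, AddMonoidHom.zero_comp]
  rw [ext_biprod_fst_eq X Y x, hX', hY', Ext.comp_zero, Ext.comp_zero, add_zero]

/-- **`α(X ⊞ Y)` injective iff `α(X)` and `α(Y)` are.** [cite: MilneADT2006, I Theorem 1.8 (proof)][cite: Harari2020, §16.3 Theorem 16.21] -/
theorem adjointInjective_biprod_iff {r s : ℕ} (h : s + r = 2) :
    AdjointInjective inv (X ⊞ Y) h ↔ AdjointInjective inv X h ∧ AdjointInjective inv Y h :=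
  ⟨fun hXY => ⟨adjointInjective_of_biprod_left inv X Y h hXY, adjointInjective_of_biprod_right inv X Y h hXY⟩,
    fun hh => adjointInjective_biprod inv X Y h hh.1 hh.2⟩

/-! ## §3 Surjectivity -/

/-- **`α(X ⊞ Y)` surjective ⟹ `α(X)` surjective.** [cite: MilneADT2006, I Theorem 1.8 (proof)][cite: Harari2020, §16.3 Theorem 16.21] -/
theorem adjointSurjective_of_biprod_left {r s : ℕ} (h : s + r = 2)
    (hXY : AdjointSurjective inv (X ⊞ Y) h) : AdjointSurjective inv X h := by
  intro Φ
  obtain ⟨x, hx⟩ := hXY (Φ.comp ((Ext.mk₀ (biprod.fst : X ⊞ Y ⟶ X)).postcomp P (add_zero s)))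
  refine ⟨(Ext.mk₀ (biprod.inl : X ⟶ X ⊞ Y)).comp x (zero_add r), ?_⟩
  rw [adjointMap_mk₀_comp, hx]
  ext y
  change Φ ((y.comp (Ext.mk₀ biprod.inl) (add_zero s)).comp (Ext.mk₀ biprod.fst) (add_zero s)) = Φ y
  rw [Ext.comp_assoc_of_third_deg_zero, Ext.mk₀_comp_mk₀, biprod.inl_fst, Ext.comp_mk₀_id]

/-- **`α(X ⊞ Y)` surjective ⟹ `α(Y)` surjective.** [cite: MilneADT2006, I Theorem 1.8 (proof)][cite: Harari2020, §16.3 Theorem 16.21] -/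
theorem adjointSurjective_of_biprod_right {r s : ℕ} (h : s + r = 2)
    (hXY : AdjointSurjective inv (X ⊞ Y) h) : AdjointSurjective inv Y h := by
  intro Φ
  obtain ⟨x, hx⟩ := hXY (Φ.comp ((Ext.mk₀ (biprod.snd : X ⊞ Y ⟶ Y)).postcomp P (add_zero s)))
  refine ⟨(Ext.mk₀ (biprod.inr : Y ⟶ X ⊞ Y)).comp x (zero_add r), ?_⟩
  rw [adjointMap_mk₀_comp, hx]
  ext y
  change Φ ((y.comp (Ext.mk₀ biprod.inr) (add_zero s)).comp (Ext.mk₀ biprod.snd) (add_zero s)) = Φ y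
  rw [Ext.comp_assoc_of_third_deg_zero, Ext.mk₀_comp_mk₀, biprod.inr_snd, Ext.comp_mk₀_id]

/-- **`α(X)`, `α(Y)` surjective ⟹ `α(X ⊞ Y)` surjective.** [cite: MilneADT2006, I Theorem 1.8 (proof)][cite: Harari2020, §16.3 Theorem 16.21] -/
theorem adjointSurjective_biprod {r s : ℕ} (h : s + r = 2) (hX : AdjointSurjective inv X h)
    (hY : AdjointSurjective inv Y h) : AdjointSurjective inv (X ⊞ Y) h := by
  intro Φ
  obtain ⟨xX, hxX⟩ := hX (Φ.comp ((Ext.mk₀ (biprod.inl : X ⟶ X ⊞ Y)).postcomp P (add_zero s)))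
  obtain ⟨xY, hxY⟩ := hY (Φ.comp ((Ext.mk₀ (biprod.inr : Y ⟶ X ⊞ Y)).postcomp P (add_zero s)))
  refine ⟨(Ext.mk₀ (biprod.fst : X ⊞ Y ⟶ X)).comp xX (zero_add r) +
    (Ext.mk₀ (biprod.snd : X ⊞ Y ⟶ Y)).comp xY (zero_add r), ?_⟩
  rw [map_add, adjointMap_mk₀_comp, adjointMap_mk₀_comp, hxX, hxY]
  ext y
  change Φ ((y.comp (Ext.mk₀ biprod.fst) (add_zero s)).comp (Ext.mk₀ biprod.inl) (add_zero s)) +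
      Φ ((y.comp (Ext.mk₀ biprod.snd) (add_zero s)).comp (Ext.mk₀ biprod.inr) (add_zero s)) = Φ y
  rw [← map_add, ← ext_biprod_snd_eq X Y y]

/-- **`α(X ⊞ Y)` surjective iff `α(X)` and `α(Y)` are.** [cite: MilneADT2006, I Theorem 1.8 (proof)][cite: Harari2020, §16.3 Theorem 16.21] -/
theorem adjointSurjective_biprod_iff {r s : ℕ} (h : s + r = 2) :
    AdjointSurjective inv (X ⊞ Y) h ↔ AdjointSurjective inv X h ∧ AdjointSurjective inv Y h :=
  ⟨fun hXY => ⟨adjointSurjective_of_biprod_left inv X Y h hXY, adjointSurjective_of_biprod_right inv X Y h hXY⟩,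
    fun hh => adjointSurjective_biprod inv X Y h hh.1 hh.2⟩

/-- **`α(X ⊞ Y)` bijective iff `α(X)` and `α(Y)` are.** [cite: MilneADT2006, I Theorem 1.8 (proof)][cite: Harari2020, §16.3 Theorem 16.21] -/
theorem adjointBijective_biprod_iff {r s : ℕ} (h : s + r = 2) :
    AdjointBijective inv (X ⊞ Y) h ↔ AdjointBijective inv X h ∧ AdjointBijective inv Y h := by
  rw [AdjointBijective, AdjointBijective, AdjointBijective, Function.Bijective, Function.Bijective,
    Function.Bijective]
  have hi := adjointInjective_biprod_iff inv X Y h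
  have hs := adjointSurjective_biprod_iff inv X Y h
  rw [AdjointInjective, AdjointInjective, AdjointInjective] at hi
  rw [AdjointSurjective, AdjointSurjective, AdjointSurjective] at hs
  tauto

/-- **Transport along an isomorphism**: `α(X)` injective iff `α(X')` is, for `X ≅ X'`.
[cite: Harari2020, §16.3 Theorem 16.21] -/
theorem adjointInjective_iff_of_iso {X X' : 𝒞} (e : X ≅ X') {r s : ℕ} (h : s + r = 2) :
    AdjointInjective inv X h ↔ AdjointInjective inv X' h := by
  constructor
  · intro hX x x' hxx'
    have key : (Ext.mk₀ e.hom).comp x (zero_add r) = (Ext.mk₀ e.hom).comp x' (zero_add r) := by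
      apply hX
      rw [adjointMap_mk₀_comp, adjointMap_mk₀_comp, hxx']
    have := congrArg (fun z => (Ext.mk₀ e.inv).comp z (zero_add r)) key
    simpa only [Ext.mk₀_comp_mk₀_assoc, Iso.inv_hom_id, Ext.mk₀_id_comp] using this
  · intro hX' x x' hxx'
    have key : (Ext.mk₀ e.inv).comp x (zero_add r) = (Ext.mk₀ e.inv).comp x' (zero_add r) := by
      apply hX'
      rw [adjointMap_mk₀_comp, adjointMap_mk₀_comp, hxx']
    have := congrArg (fun z => (Ext.mk₀ e.hom).comp z (zero_add r)) key
    simpa only [Ext.mk₀_comp_mk₀_assoc, Iso.hom_inv_id, Ext.mk₀_id_comp] using this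

/-- **Transport along an isomorphism**: `α(X)` surjective iff `α(X')` is, for `X ≅ X'`.
[cite: Harari2020, §16.3 Theorem 16.21] -/
theorem adjointSurjective_iff_of_iso {X X' : 𝒞} (e : X ≅ X') {r s : ℕ} (h : s + r = 2) :
    AdjointSurjective inv X h ↔ AdjointSurjective inv X' h := by
  constructor
  · intro hX Φ
    obtain ⟨x, hx⟩ := hX (Φ.comp ((Ext.mk₀ e.hom).postcomp P (add_zero s)))
    refine ⟨(Ext.mk₀ e.inv).comp x (zero_add r), ?_⟩
    rw [adjointMap_mk₀_comp, hx]
    ext y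
    change Φ ((y.comp (Ext.mk₀ e.inv) (add_zero s)).comp (Ext.mk₀ e.hom) (add_zero s)) = Φ y
    rw [Ext.comp_assoc_of_third_deg_zero, Ext.mk₀_comp_mk₀, Iso.inv_hom_id, Ext.comp_mk₀_id]
  · intro hX' Φ
    obtain ⟨x, hx⟩ := hX' (Φ.comp ((Ext.mk₀ e.inv).postcomp P (add_zero s)))
    refine ⟨(Ext.mk₀ e.hom).comp x (zero_add r), ?_⟩
    rw [adjointMap_mk₀_comp, hx]
    ext y
    change Φ ((y.comp (Ext.mk₀ e.hom) (add_zero s)).comp (Ext.mk₀ e.inv) (add_zero s)) = Φ y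
    rw [Ext.comp_assoc_of_third_deg_zero, Ext.mk₀_comp_mk₀, Iso.hom_inv_id, Ext.comp_mk₀_id]

/-- **Transport along an isomorphism**, bijective form. [cite: Harari2020, §16.3 Theorem 16.21] -/
theorem adjointBijective_iff_of_iso {X X' : 𝒞} (e : X ≅ X') {r s : ℕ} (h : s + r = 2) :
    AdjointBijective inv X h ↔ AdjointBijective inv X' h :=
  and_congr (adjointInjective_iff_of_iso inv e h) (adjointSurjective_iff_of_iso inv e h)

/-- Vanishing of `Extʳ(–, C)` transports along isomorphisms and to binary biproducts
(the rows `r ≥ 3`). [cite: Harari2020, §16.3 Lemma 16.19] -/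
theorem ext_eq_zero_of_iso {X X' : 𝒞} (e : X ≅ X') {r : ℕ} (hX' : ∀ x : Ext X' C r, x = 0)
    (x : Ext X C r) : x = 0 := by
  have h1 : (Ext.mk₀ e.inv).comp x (zero_add r) = 0 := hX' _
  have := congrArg (fun z => (Ext.mk₀ e.hom).comp z (zero_add r)) h1
  simpa only [Ext.mk₀_comp_mk₀_assoc, Iso.hom_inv_id, Ext.mk₀_id_comp, Ext.comp_zero] using this

/-- `Extʳ(X ⊞ Y, C) = 0` iff `Extʳ(X, C) = 0` and `Extʳ(Y, C) = 0`. [cite: Harari2020, §16.3 Lemma 16.19] -/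
theorem ext_biprod_eq_zero_iff {r : ℕ} :
    (∀ x : Ext (X ⊞ Y) C r, x = 0) ↔ (∀ x : Ext X C r, x = 0) ∧ (∀ x : Ext Y C r, x = 0) := by
  constructor
  · intro hXY
    refine ⟨fun x => ?_, fun x => ?_⟩
    · have h1 := hXY ((Ext.mk₀ (biprod.fst : X ⊞ Y ⟶ X)).comp x (zero_add r))
      have := congrArg (fun z => (Ext.mk₀ (biprod.inl : X ⟶ X ⊞ Y)).comp z (zero_add r)) h1
      simpa only [Ext.mk₀_comp_mk₀_assoc, biprod.inl_fst, Ext.mk₀_id_comp, Ext.comp_zero] using this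
    · have h1 := hXY ((Ext.mk₀ (biprod.snd : X ⊞ Y ⟶ Y)).comp x (zero_add r))
      have := congrArg (fun z => (Ext.mk₀ (biprod.inr : Y ⟶ X ⊞ Y)).comp z (zero_add r)) h1
      simpa only [Ext.mk₀_comp_mk₀_assoc, biprod.inr_snd, Ext.mk₀_id_comp, Ext.comp_zero] using this
  · rintro ⟨hX, hY⟩ x
    rw [ext_biprod_fst_eq X Y x, hX ((Ext.mk₀ biprod.inl).comp x (zero_add r)),
      hY ((Ext.mk₀ biprod.inr).comp x (zero_add r)), Ext.comp_zero, Ext.comp_zero, add_zero]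

end ExtDuality

end Literature.Algebra.Homology
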